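import Mathlib

/-!
# SoloInformedValTrapezoid — an explicit equilateral-trapezoid-free triple with `54000` solutions

Pratt [arXiv:2309.03878 (ITCS 2024), Def. 3.2/4.2] calls `(A, B, C)` *equilateral trapezoid-free* for the
target `t` if for all fixed `a' ∈ A, b' ∈ B, c' ∈ C` each of the systems `t = a'+b+c = a+b'+c`,
`t = a'+b+c = a+b+c'`, `t = a+b'+c = a+b+c'` has at most one solution `(a,b,c) ∈ A × B × C`; `Val(n)` is the
maximum number of solutions of `a+b+c = n` over such triples in `{0,…,n}` (trivially `≥ n+1`),
and his Conjecture 4.1 ("our weakest conjecture") reads `Val(ℤ_n) ≤ O(n^{1+ε})`, with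
`Val(ℤ_n) ≥ Val(⌊n/3⌋)` (Prop. 4.3).

This file kernel-checks the BASE INSTANCE of the soloist's counterexample family (gen 65; dossier
`paper/val-superlinear.md`): the carry-free integer form of the Cohn–Kleinberg–Szegedy–Umans two-triple STPP
(arXiv:math/0511460, Thm. 33 for the local strong USP `{(1,2,3),(3,1,2)}`) in balanced base `33` with the
digit set `P = [-16,16] \ {-1,0,1}` (30 digits): `X = Q₁₀ ∪ Q₂₁`, `Y = Q₂₁ ∪ Q₀₂`, `Z = Q₀₂ ∪ Q₁₀` where
`Q₁₀ = {33y - x}`, `Q₂₁ = {1089z - 33y}`, `Q₀₂ = {x - 1089z}` (`x y z ∈ P`).  Results: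

* `trapezoidFree_XYZ` : `(X, Y, Z)` is equilateral trapezoid-free for the target `0`;
* `card_solutions_ge` : `a + b + c = 0` has at least `54000 = 2·30³` solutions in `X × Y × Z`;
* `X_bound`, `Y_bound`, `Z_bound` : `X, Y ⊆ [-17952, 17952]`, `Z ⊆ [-17440, 17440]`;
* `val_witness_XYZ` : the conjunction.

Translating by `(17952, 17952, 17440)` puts the triple in Pratt's normal form inside `{0,…,n}`, `n = 53344`, with
`A + B + C ⊆ [0, 2n]` and `54000 > n + 1` solutions of `a+b+c = n` (sequel file `SoloInformedValNormalForm`);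
the digit-product lemma of the dossier then gives `Val(N) ≥ N^{log 54000/log 53345}` for infinitely many `N` and the
full family gives `Val(ℤ_N) ≫ N^{1.04}`, refuting Conjecture 4.1.  Technique: every element of `X ∪ Y ∪ Z` has a
two-digit normal form; `u + v + w = 0` on `X × Y × Z` forces one of the two intended digit patterns (`tri`: `omega`
on ≤ 6 digits, the hole `d ∉ {-1,0,1}` kept opaque as `Hole` and used only through `Hole.elim`); the three systems
follow from uniqueness (`U10 U21 U02`) and disjointness (`D1021 D2102 D0210`) of normal forms.  The 1800-element
sets are `irreducible` so that elaboration never evaluates them.  Standard axioms only.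
-/


namespace Summit.MatrixMultiplication.MatrixMultiplication.Theorems.SoloVal

open Finset

/-- Pratt's equilateral-trapezoid-freeness (arXiv:2309.03878, Def. 3.2/4.2) for finite `A, B, C ⊆ ℤ`
and target `t`.  System (1) (`a', b'` fixed) is determined by `c`, system (2) (`a', c'` fixed) by `b`,
system (3) (`b', c'` fixed) by `a`; "at most one solution" is stated as uniqueness of that coordinate. -/
def TrapezoidFree (A B C : Finset ℤ) (t : ℤ) : Prop :=
  (∀ a' ∈ A, ∀ b' ∈ B, ∀ c₁ ∈ C, ∀ c₂ ∈ C,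
      t - a' - c₁ ∈ B → t - b' - c₁ ∈ A → t - a' - c₂ ∈ B → t - b' - c₂ ∈ A → c₁ = c₂) ∧
  (∀ a' ∈ A, ∀ c' ∈ C, ∀ b₁ ∈ B, ∀ b₂ ∈ B,
      t - a' - b₁ ∈ C → t - c' - b₁ ∈ A → t - a' - b₂ ∈ C → t - c' - b₂ ∈ A → b₁ = b₂) ∧
  (∀ b' ∈ B, ∀ c' ∈ C, ∀ a₁ ∈ A, ∀ a₂ ∈ A,
      t - b' - a₁ ∈ C → t - c' - a₁ ∈ B → t - b' - a₂ ∈ C → t - c' - a₂ ∈ B → a₁ = a₂)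

/-- The solutions of `a + b + c = t` in `A × B × C`. -/
def solutions (A B C : Finset ℤ) (t : ℤ) : Finset (ℤ × ℤ × ℤ) :=
  (A ×ˢ B ×ˢ C).filter (fun p => p.1 + p.2.1 + p.2.2 = t)

/-- The digit "hole": `d ∉ {-1, 0, 1}`.  Kept as a definition so that `omega` ignores it. -/
def Hole (d : ℤ) : Prop := d ≠ 0 ∧ d ≠ 1 ∧ d ≠ -1

/-- A digit in the hole contradicts `Hole`. -/
theorem Hole.elim {d : ℤ} (h : Hole d) (h' : d = 0 ∨ d = 1 ∨ d = -1) : False := by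
  rcases h with ⟨h0, h1, h2⟩
  rcases h' with h' | h' | h' <;> contradiction

/-- Digit set `P = [-16, 16] \ {-1, 0, 1} = [-16,-2] ∪ [2,16]` (balanced base 33, 30 digits). -/
noncomputable def P : Finset ℤ := Icc (-16 : ℤ) (-2) ∪ Icc 2 16

/-- Digits lie in `[-16, 16]`. -/
theorem P_bounds {d : ℤ} (h : d ∈ P) : -16 ≤ d ∧ d ≤ 16 := by
  simp only [P, mem_union, mem_Icc] at h
  omega

/-- Digits avoid `{-1, 0, 1}`. -/
theorem P_hole {d : ℤ} (h : d ∈ P) : Hole d := by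
  simp only [P, mem_union, mem_Icc] at h
  unfold Hole
  refine ⟨?_, ?_, ?_⟩ <;> omega

/-- There are `30` digits. -/
theorem card_P : P.card = 30 := by
  rw [P, card_union_of_disjoint]
  · rw [Int.card_Icc, Int.card_Icc]; rfl
  · rw [Finset.disjoint_left]
    intro d h1 h2
    rw [mem_Icc] at h1 h2
    omega

/-- `Q₁₀ = {33 y - x : x y ∈ P}`. -/
noncomputable def Q10 : Finset ℤ := (P ×ˢ P).image (fun p => 33 * p.2 - p.1)
/-- `Q₂₁ = {1089 z - 33 y : y z ∈ P}`. -/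
noncomputable def Q21 : Finset ℤ := (P ×ˢ P).image (fun p => 1089 * p.2 - 33 * p.1)
/-- `Q₀₂ = {x - 1089 z : x z ∈ P}`. -/
noncomputable def Q02 : Finset ℤ := (P ×ˢ P).image (fun p => p.1 - 1089 * p.2)

/-- `X = Q₁₀ ∪ Q₂₁` (the sets are `irreducible`: elaboration must never evaluate them by `whnf`). -/
@[irreducible] noncomputable def X : Finset ℤ := Q10 ∪ Q21
/-- `Y = Q₂₁ ∪ Q₀₂`. -/
@[irreducible] noncomputable def Y : Finset ℤ := Q21 ∪ Q02
/-- `Z = Q₀₂ ∪ Q₁₀`. -/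
@[irreducible] noncomputable def Z : Finset ℤ := Q02 ∪ Q10

/-- Membership in `Q₁₀`. -/
theorem mem_Q10 {v : ℤ} : v ∈ Q10 ↔ ∃ x y, x ∈ P ∧ y ∈ P ∧ 33 * y - x = v := by
  constructor
  · intro h
    obtain ⟨⟨x, y⟩, hxy, rfl⟩ := mem_image.1 h
    exact ⟨x, y, (mem_product.1 hxy).1, (mem_product.1 hxy).2, rfl⟩
  · rintro ⟨x, y, hx, hy, rfl⟩
    exact mem_image.2 ⟨(x, y), mem_product.2 ⟨hx, hy⟩, rfl⟩

/-- Membership in `Q₂₁`. -/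
theorem mem_Q21 {v : ℤ} : v ∈ Q21 ↔ ∃ x y, x ∈ P ∧ y ∈ P ∧ 1089 * y - 33 * x = v := by
  constructor
  · intro h
    obtain ⟨⟨x, y⟩, hxy, rfl⟩ := mem_image.1 h
    exact ⟨x, y, (mem_product.1 hxy).1, (mem_product.1 hxy).2, rfl⟩
  · rintro ⟨x, y, hx, hy, rfl⟩
    exact mem_image.2 ⟨(x, y), mem_product.2 ⟨hx, hy⟩, rfl⟩

/-- Membership in `Q₀₂`. -/
theorem mem_Q02 {v : ℤ} : v ∈ Q02 ↔ ∃ x y, x ∈ P ∧ y ∈ P ∧ x - 1089 * y = v := by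
  constructor
  · intro h
    obtain ⟨⟨x, y⟩, hxy, rfl⟩ := mem_image.1 h
    exact ⟨x, y, (mem_product.1 hxy).1, (mem_product.1 hxy).2, rfl⟩
  · rintro ⟨x, y, hx, hy, rfl⟩
    exact mem_image.2 ⟨(x, y), mem_product.2 ⟨hx, hy⟩, rfl⟩

/-- The normal form `33 q - p` determines its digits. -/
theorem U10 {p q p' q' : ℤ} (h : 33 * q - p = 33 * q' - p') (hp : p ∈ P) (hq : q ∈ P)
    (hp' : p' ∈ P) (hq' : q' ∈ P) : p = p' ∧ q = q' := by
  obtain ⟨_, _⟩ := P_bounds hp; obtain ⟨_, _⟩ := P_bounds hq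
  obtain ⟨_, _⟩ := P_bounds hp'; obtain ⟨_, _⟩ := P_bounds hq'
  constructor <;> omega

/-- The normal form `1089 r - 33 q` determines its digits. -/
theorem U21 {q r q' r' : ℤ} (h : 1089 * r - 33 * q = 1089 * r' - 33 * q') (hq : q ∈ P) (hr : r ∈ P)
    (hq' : q' ∈ P) (hr' : r' ∈ P) : q = q' ∧ r = r' := by
  obtain ⟨_, _⟩ := P_bounds hq; obtain ⟨_, _⟩ := P_bounds hr
  obtain ⟨_, _⟩ := P_bounds hq'; obtain ⟨_, _⟩ := P_bounds hr'
  constructor <;> omega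

/-- The normal form `p - 1089 r` determines its digits. -/
theorem U02 {p r p' r' : ℤ} (h : p - 1089 * r = p' - 1089 * r') (hp : p ∈ P) (hr : r ∈ P)
    (hp' : p' ∈ P) (hr' : r' ∈ P) : p = p' ∧ r = r' := by
  obtain ⟨_, _⟩ := P_bounds hp; obtain ⟨_, _⟩ := P_bounds hr
  obtain ⟨_, _⟩ := P_bounds hp'; obtain ⟨_, _⟩ := P_bounds hr'
  constructor <;> omega

/-- `Q₁₀` and `Q₂₁` are disjoint. -/
theorem D1021 {p q q' r' : ℤ} (h : 33 * q - p = 1089 * r' - 33 * q') (hp : p ∈ P) (hq : q ∈ P)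
    (hq' : q' ∈ P) (hr' : r' ∈ P) : False := by
  obtain ⟨_, _⟩ := P_bounds hp; obtain ⟨_, _⟩ := P_bounds hq
  obtain ⟨_, _⟩ := P_bounds hq'; obtain ⟨_, _⟩ := P_bounds hr'
  exact Hole.elim (P_hole hp) (by omega)

/-- `Q₂₁` and `Q₀₂` are disjoint. -/
theorem D2102 {q r p' r' : ℤ} (h : 1089 * r - 33 * q = p' - 1089 * r') (hq : q ∈ P) (hr : r ∈ P)
    (hp' : p' ∈ P) (hr' : r' ∈ P) : False := by
  obtain ⟨_, _⟩ := P_bounds hq; obtain ⟨_, _⟩ := P_bounds hr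
  obtain ⟨_, _⟩ := P_bounds hp'; obtain ⟨_, _⟩ := P_bounds hr'
  exact Hole.elim (P_hole hp') (by omega)

/-- `Q₀₂` and `Q₁₀` are disjoint. -/
theorem D0210 {p r p' q' : ℤ} (h : p - 1089 * r = 33 * q' - p') (hp : p ∈ P) (hr : r ∈ P)
    (hp' : p' ∈ P) (hq' : q' ∈ P) : False := by
  obtain ⟨_, _⟩ := P_bounds hp; obtain ⟨_, _⟩ := P_bounds hr
  obtain ⟨_, _⟩ := P_bounds hp'; obtain ⟨_, _⟩ := P_bounds hq'
  exact Hole.elim (P_hole hr) (by omega)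

/-- A zero-sum transversal of `X × Y × Z` is `(33q-p, 1089r-33q, p-1089r)` or `(1089r-33q, p-1089r, 33q-p)`. -/
theorem tri {u v w : ℤ} (hu : u ∈ X) (hv : v ∈ Y) (hw : w ∈ Z) (h : u + v + w = 0) :
    (∃ p q r, p ∈ P ∧ q ∈ P ∧ r ∈ P ∧ u = 33 * q - p ∧ v = 1089 * r - 33 * q ∧ w = p - 1089 * r) ∨
    (∃ p q r, p ∈ P ∧ q ∈ P ∧ r ∈ P ∧ u = 1089 * r - 33 * q ∧ v = p - 1089 * r ∧ w = 33 * q - p) := by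
  simp only [X, Y, Z, mem_union, mem_Q10, mem_Q21, mem_Q02] at hu hv hw
  rcases hu with ⟨a1, b1, ha1, hb1, rfl⟩ | ⟨a1, b1, ha1, hb1, rfl⟩ <;>
  rcases hv with ⟨a2, b2, ha2, hb2, rfl⟩ | ⟨a2, b2, ha2, hb2, rfl⟩ <;>
  rcases hw with ⟨a3, b3, ha3, hb3, rfl⟩ | ⟨a3, b3, ha3, hb3, rfl⟩ <;>
  ( obtain ⟨xa1, ya1⟩ := P_bounds ha1; obtain ⟨xb1, yb1⟩ := P_bounds hb1
    obtain ⟨xa2, ya2⟩ := P_bounds ha2; obtain ⟨xb2, yb2⟩ := P_bounds hb2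
    obtain ⟨xa3, ya3⟩ := P_bounds ha3; obtain ⟨xb3, yb3⟩ := P_bounds hb3
    first
    | exact Or.inl ⟨a1, b1, b2, ha1, hb1, hb2, by omega, by omega, by omega⟩
    | exact Or.inr ⟨a2, a1, b1, ha2, ha1, hb1, by omega, by omega, by omega⟩
    | exact (Hole.elim (P_hole ha1) (by omega)).elim
    | exact (Hole.elim (P_hole hb1) (by omega)).elim
    | exact (Hole.elim (P_hole ha2) (by omega)).elim
    | exact (Hole.elim (P_hole hb2) (by omega)).elim
    | exact (Hole.elim (P_hole ha3) (by omega)).elim )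

/-- System (1): for fixed `a' ∈ X`, `b' ∈ Y` at most one `c`. -/
theorem sys1 : ∀ a' ∈ X, ∀ b' ∈ Y, ∀ c₁ ∈ Z, ∀ c₂ ∈ Z,
    0 - a' - c₁ ∈ Y → 0 - b' - c₁ ∈ X → 0 - a' - c₂ ∈ Y → 0 - b' - c₂ ∈ X → c₁ = c₂ := by
  intro a' ha' b' hb' c₁ hc₁ c₂ hc₂ h1 h2 h3 h4
  have T1 := tri ha' h1 hc₁ (by ring); have T2 := tri h2 hb' hc₁ (by ring)
  have T3 := tri ha' h3 hc₂ (by ring); have T4 := tri h4 hb' hc₂ (by ring)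
  rcases T1 with ⟨p1, q1, r1, hp1, hq1, hr1, ea1, -, ec1⟩ | ⟨p1, q1, r1, hp1, hq1, hr1, ea1, -, ec1⟩ <;>
  rcases T2 with ⟨p2, q2, r2, hp2, hq2, hr2, -, eb2, ec2⟩ | ⟨p2, q2, r2, hp2, hq2, hr2, -, eb2, ec2⟩ <;>
  rcases T3 with ⟨p3, q3, r3, hp3, hq3, hr3, ea3, -, ec3⟩ | ⟨p3, q3, r3, hp3, hq3, hr3, ea3, -, ec3⟩ <;>
  rcases T4 with ⟨p4, q4, r4, hp4, hq4, hr4, -, eb4, ec4⟩ | ⟨p4, q4, r4, hp4, hq4, hr4, -, eb4, ec4⟩ <;>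
  first
  | exact (D1021 (ea1.symm.trans ea3) ‹_› ‹_› ‹_› ‹_›).elim
  | exact (D1021 (ea3.symm.trans ea1) ‹_› ‹_› ‹_› ‹_›).elim
  | exact (D2102 (eb2.symm.trans eb4) ‹_› ‹_› ‹_› ‹_›).elim
  | exact (D2102 (eb4.symm.trans eb2) ‹_› ‹_› ‹_› ‹_›).elim
  | exact (D0210 (ec1.symm.trans ec2) ‹_› ‹_› ‹_› ‹_›).elim
  | exact (D0210 (ec2.symm.trans ec1) ‹_› ‹_› ‹_› ‹_›).elim
  | exact (D0210 (ec3.symm.trans ec4) ‹_› ‹_› ‹_› ‹_›).elim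
  | exact (D0210 (ec4.symm.trans ec3) ‹_› ‹_› ‹_› ‹_›).elim
  | ( obtain ⟨u1, u2⟩ := U10 (ea1.symm.trans ea3) ‹_› ‹_› ‹_› ‹_›
      obtain ⟨u3, u4⟩ := U21 (eb2.symm.trans eb4) ‹_› ‹_› ‹_› ‹_›
      obtain ⟨u5, u6⟩ := U02 (ec1.symm.trans ec2) ‹_› ‹_› ‹_› ‹_›
      obtain ⟨u7, u8⟩ := U02 (ec3.symm.trans ec4) ‹_› ‹_› ‹_› ‹_›
      omega )
  | ( obtain ⟨u1, u2⟩ := U21 (ea1.symm.trans ea3) ‹_› ‹_› ‹_› ‹_›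
      obtain ⟨u3, u4⟩ := U02 (eb2.symm.trans eb4) ‹_› ‹_› ‹_› ‹_›
      obtain ⟨u5, u6⟩ := U10 (ec1.symm.trans ec2) ‹_› ‹_› ‹_› ‹_›
      obtain ⟨u7, u8⟩ := U10 (ec3.symm.trans ec4) ‹_› ‹_› ‹_› ‹_›
      omega )

/-- System (2): for fixed `a' ∈ X`, `c' ∈ Z` at most one `b`. -/
theorem sys2 : ∀ a' ∈ X, ∀ c' ∈ Z, ∀ b₁ ∈ Y, ∀ b₂ ∈ Y,
    0 - a' - b₁ ∈ Z → 0 - c' - b₁ ∈ X → 0 - a' - b₂ ∈ Z → 0 - c' - b₂ ∈ X → b₁ = b₂ := by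
  intro a' ha' c' hc' b₁ hb₁ b₂ hb₂ h1 h2 h3 h4
  have T1 := tri ha' hb₁ h1 (by ring); have T2 := tri h2 hb₁ hc' (by ring)
  have T3 := tri ha' hb₂ h3 (by ring); have T4 := tri h4 hb₂ hc' (by ring)
  rcases T1 with ⟨p1, q1, r1, hp1, hq1, hr1, ea1, eb1, -⟩ | ⟨p1, q1, r1, hp1, hq1, hr1, ea1, eb1, -⟩ <;>
  rcases T2 with ⟨p2, q2, r2, hp2, hq2, hr2, -, eb2, ec2⟩ | ⟨p2, q2, r2, hp2, hq2, hr2, -, eb2, ec2⟩ <;>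
  rcases T3 with ⟨p3, q3, r3, hp3, hq3, hr3, ea3, eb3, -⟩ | ⟨p3, q3, r3, hp3, hq3, hr3, ea3, eb3, -⟩ <;>
  rcases T4 with ⟨p4, q4, r4, hp4, hq4, hr4, -, eb4, ec4⟩ | ⟨p4, q4, r4, hp4, hq4, hr4, -, eb4, ec4⟩ <;>
  first
  | exact (D1021 (ea1.symm.trans ea3) ‹_› ‹_› ‹_› ‹_›).elim
  | exact (D1021 (ea3.symm.trans ea1) ‹_› ‹_› ‹_› ‹_›).elim
  | exact (D0210 (ec2.symm.trans ec4) ‹_› ‹_› ‹_› ‹_›).elim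
  | exact (D0210 (ec4.symm.trans ec2) ‹_› ‹_› ‹_› ‹_›).elim
  | exact (D2102 (eb1.symm.trans eb2) ‹_› ‹_› ‹_› ‹_›).elim
  | exact (D2102 (eb2.symm.trans eb1) ‹_› ‹_› ‹_› ‹_›).elim
  | exact (D2102 (eb3.symm.trans eb4) ‹_› ‹_› ‹_› ‹_›).elim
  | exact (D2102 (eb4.symm.trans eb3) ‹_› ‹_› ‹_› ‹_›).elim
  | ( obtain ⟨u1, u2⟩ := U10 (ea1.symm.trans ea3) ‹_› ‹_› ‹_› ‹_›
      obtain ⟨u3, u4⟩ := U02 (ec2.symm.trans ec4) ‹_› ‹_› ‹_› ‹_›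
      obtain ⟨u5, u6⟩ := U21 (eb1.symm.trans eb2) ‹_› ‹_› ‹_› ‹_›
      obtain ⟨u7, u8⟩ := U21 (eb3.symm.trans eb4) ‹_› ‹_› ‹_› ‹_›
      omega )
  | ( obtain ⟨u1, u2⟩ := U21 (ea1.symm.trans ea3) ‹_› ‹_› ‹_› ‹_›
      obtain ⟨u3, u4⟩ := U10 (ec2.symm.trans ec4) ‹_› ‹_› ‹_› ‹_›
      obtain ⟨u5, u6⟩ := U02 (eb1.symm.trans eb2) ‹_› ‹_› ‹_› ‹_›
      obtain ⟨u7, u8⟩ := U02 (eb3.symm.trans eb4) ‹_› ‹_› ‹_› ‹_›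
      omega )

/-- System (3): for fixed `b' ∈ Y`, `c' ∈ Z` at most one `a`. -/
theorem sys3 : ∀ b' ∈ Y, ∀ c' ∈ Z, ∀ a₁ ∈ X, ∀ a₂ ∈ X,
    0 - b' - a₁ ∈ Z → 0 - c' - a₁ ∈ Y → 0 - b' - a₂ ∈ Z → 0 - c' - a₂ ∈ Y → a₁ = a₂ := by
  intro b' hb' c' hc' a₁ ha₁ a₂ ha₂ h1 h2 h3 h4
  have T1 := tri ha₁ hb' h1 (by ring); have T2 := tri ha₁ h2 hc' (by ring)
  have T3 := tri ha₂ hb' h3 (by ring); have T4 := tri ha₂ h4 hc' (by ring)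
  rcases T1 with ⟨p1, q1, r1, hp1, hq1, hr1, ea1, eb1, -⟩ | ⟨p1, q1, r1, hp1, hq1, hr1, ea1, eb1, -⟩ <;>
  rcases T2 with ⟨p2, q2, r2, hp2, hq2, hr2, ea2, -, ec2⟩ | ⟨p2, q2, r2, hp2, hq2, hr2, ea2, -, ec2⟩ <;>
  rcases T3 with ⟨p3, q3, r3, hp3, hq3, hr3, ea3, eb3, -⟩ | ⟨p3, q3, r3, hp3, hq3, hr3, ea3, eb3, -⟩ <;>
  rcases T4 with ⟨p4, q4, r4, hp4, hq4, hr4, ea4, -, ec4⟩ | ⟨p4, q4, r4, hp4, hq4, hr4, ea4, -, ec4⟩ <;>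
  first
  | exact (D2102 (eb1.symm.trans eb3) ‹_› ‹_› ‹_› ‹_›).elim
  | exact (D2102 (eb3.symm.trans eb1) ‹_› ‹_› ‹_› ‹_›).elim
  | exact (D0210 (ec2.symm.trans ec4) ‹_› ‹_› ‹_› ‹_›).elim
  | exact (D0210 (ec4.symm.trans ec2) ‹_› ‹_› ‹_› ‹_›).elim
  | exact (D1021 (ea1.symm.trans ea2) ‹_› ‹_› ‹_› ‹_›).elim
  | exact (D1021 (ea2.symm.trans ea1) ‹_› ‹_› ‹_› ‹_›).elim
  | exact (D1021 (ea3.symm.trans ea4) ‹_› ‹_› ‹_› ‹_›).elim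
  | exact (D1021 (ea4.symm.trans ea3) ‹_› ‹_› ‹_› ‹_›).elim
  | ( obtain ⟨u1, u2⟩ := U21 (eb1.symm.trans eb3) ‹_› ‹_› ‹_› ‹_›
      obtain ⟨u3, u4⟩ := U02 (ec2.symm.trans ec4) ‹_› ‹_› ‹_› ‹_›
      obtain ⟨u5, u6⟩ := U10 (ea1.symm.trans ea2) ‹_› ‹_› ‹_› ‹_›
      obtain ⟨u7, u8⟩ := U10 (ea3.symm.trans ea4) ‹_› ‹_› ‹_› ‹_›
      omega )
  | ( obtain ⟨u1, u2⟩ := U02 (eb1.symm.trans eb3) ‹_› ‹_› ‹_› ‹_›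
      obtain ⟨u3, u4⟩ := U10 (ec2.symm.trans ec4) ‹_› ‹_› ‹_› ‹_›
      obtain ⟨u5, u6⟩ := U21 (ea1.symm.trans ea2) ‹_› ‹_› ‹_› ‹_›
      obtain ⟨u7, u8⟩ := U21 (ea3.symm.trans ea4) ‹_› ‹_› ‹_› ‹_›
      omega )

/-- The triple `(X, Y, Z)` is equilateral trapezoid-free for target `0`. -/
theorem trapezoidFree_XYZ : TrapezoidFree X Y Z 0 := And.intro sys1 (And.intro sys2 sys3)

/-- Source of the solution count: two intended patterns per digit triple. -/
noncomputable def src : Finset ((ℤ × ℤ × ℤ) × ℤ) := (P ×ˢ P ×ˢ P) ×ˢ ({0, 1} : Finset ℤ)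

/-- Membership in `src`. -/
theorem mem_src {a : (ℤ × ℤ × ℤ) × ℤ} :
    a ∈ src ↔ (a.1.1 ∈ P ∧ a.1.2.1 ∈ P ∧ a.1.2.2 ∈ P) ∧ (a.2 = 0 ∨ a.2 = 1) := by
  simp only [src, mem_product, mem_insert, mem_singleton]

/-- `src` has `2 · 30³ = 54000` elements. -/
theorem card_src : src.card = 54000 := by
  have h2 : ({0, 1} : Finset ℤ).card = 2 := card_pair (by norm_num)
  rw [src, card_product, card_product, card_product, card_P, h2]

/- `src` is a 54000-element iterated product; keep elaboration from ever evaluating it. -/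
attribute [irreducible] src

/-- The two intended solution patterns, indexed by a tag `e ∈ {0, 1}`. -/
def emb (a : (ℤ × ℤ × ℤ) × ℤ) : ℤ × ℤ × ℤ :=
  if a.2 = 0 then (33 * a.1.2.1 - a.1.1, 1089 * a.1.2.2 - 33 * a.1.2.1, a.1.1 - 1089 * a.1.2.2)
  else (1089 * a.1.2.2 - 33 * a.1.2.1, a.1.1 - 1089 * a.1.2.2, 33 * a.1.2.1 - a.1.1)

/-- Both patterns are solutions of `a + b + c = 0` in `X × Y × Z`. -/
theorem emb_mem {p q r e : ℤ} (hp : p ∈ P) (hq : q ∈ P) (hr : r ∈ P) (he : e = 0 ∨ e = 1) :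
    emb ((p, q, r), e) ∈ solutions X Y Z 0 := by
  rcases he with rfl | rfl
  · have E : emb ((p, q, r), (0 : ℤ)) = (33 * q - p, 1089 * r - 33 * q, p - 1089 * r) := by
      simp [emb]
    rw [E, solutions, mem_filter]
    refine ⟨?_, show 33 * q - p + (1089 * r - 33 * q) + (p - 1089 * r) = 0 by ring⟩
    simp only [mem_product, X, Y, Z, mem_union]
    exact ⟨Or.inl (mem_Q10.2 ⟨p, q, hp, hq, rfl⟩), Or.inl (mem_Q21.2 ⟨q, r, hq, hr, rfl⟩),
      Or.inl (mem_Q02.2 ⟨p, r, hp, hr, rfl⟩)⟩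
  · have E : emb ((p, q, r), (1 : ℤ)) = (1089 * r - 33 * q, p - 1089 * r, 33 * q - p) := by
      simp [emb]
    rw [E, solutions, mem_filter]
    refine ⟨?_, show 1089 * r - 33 * q + (p - 1089 * r) + (33 * q - p) = 0 by ring⟩
    simp only [mem_product, X, Y, Z, mem_union]
    exact ⟨Or.inr (mem_Q21.2 ⟨q, r, hq, hr, rfl⟩), Or.inr (mem_Q02.2 ⟨p, r, hp, hr, rfl⟩),
      Or.inr (mem_Q10.2 ⟨p, q, hp, hq, rfl⟩)⟩

/-- Pattern `0`. -/
theorem emb_zero (p q r : ℤ) :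
    emb ((p, q, r), 0) = (33 * q - p, 1089 * r - 33 * q, p - 1089 * r) := by
  simp [emb]

/-- Pattern `1`. -/
theorem emb_one (p q r : ℤ) :
    emb ((p, q, r), 1) = (1089 * r - 33 * q, p - 1089 * r, 33 * q - p) := by
  simp [emb]

/-- Distinct sources give distinct solutions. -/
theorem emb_injOn : Set.InjOn emb (src : Set ((ℤ × ℤ × ℤ) × ℤ)) := by
  rintro ⟨⟨p, q, r⟩, e⟩ ha ⟨⟨p', q', r'⟩, e'⟩ ha' h
  rw [mem_coe] at ha ha'
  simp only [mem_src] at ha ha'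
  obtain ⟨⟨hp, hq, hr⟩, he⟩ := ha
  obtain ⟨⟨hp', hq', hr'⟩, he'⟩ := ha'
  rcases he with rfl | rfl <;> rcases he' with rfl | rfl <;>
    simp only [emb_zero, emb_one, Prod.mk.injEq] at h
  · obtain ⟨h1, h2, -⟩ := h
    obtain ⟨e1, e2⟩ := U10 h1 hp hq hp' hq'
    obtain ⟨-, e3⟩ := U21 h2 hq hr hq' hr'
    subst e1 e2 e3
    rfl
  · exact (D1021 h.1 hp hq hq' hr').elim
  · exact (D1021 h.1.symm hp' hq' hq hr).elim
  · obtain ⟨h1, h2, -⟩ := h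
    obtain ⟨e1, e2⟩ := U21 h1 hq hr hq' hr'
    obtain ⟨e3, -⟩ := U02 h2 hp hr hp' hr'
    subst e1 e2 e3
    rfl

/-- `a + b + c = 0` has at least `54000` solutions in `X × Y × Z`. -/
theorem card_solutions_ge : 54000 ≤ (solutions X Y Z 0).card := by
  rw [← card_src]
  refine card_le_card_of_injOn emb ?_ emb_injOn
  rintro ⟨⟨p, q, r⟩, e⟩ ha
  rw [mem_coe] at ha ⊢
  simp only [mem_src] at ha
  obtain ⟨⟨hp, hq, hr⟩, he⟩ := ha
  exact emb_mem hp hq hr he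

/-- `X ⊆ [-17952, 17952]`. -/
theorem X_bound : ∀ v ∈ X, -17952 ≤ v ∧ v ≤ 17952 := by
  intro v hv
  simp only [X, mem_union, mem_Q10, mem_Q21] at hv
  rcases hv with ⟨a, b, ha, hb, rfl⟩ | ⟨a, b, ha, hb, rfl⟩ <;>
  ( obtain ⟨_, _⟩ := P_bounds ha; obtain ⟨_, _⟩ := P_bounds hb
    constructor <;> omega )

/-- `Y ⊆ [-17952, 17952]`. -/
theorem Y_bound : ∀ v ∈ Y, -17952 ≤ v ∧ v ≤ 17952 := by
  intro v hv
  simp only [Y, mem_union, mem_Q21, mem_Q02] at hv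
  rcases hv with ⟨a, b, ha, hb, rfl⟩ | ⟨a, b, ha, hb, rfl⟩ <;>
  ( obtain ⟨_, _⟩ := P_bounds ha; obtain ⟨_, _⟩ := P_bounds hb
    constructor <;> omega )

/-- `Z ⊆ [-17440, 17440]`. -/
theorem Z_bound : ∀ v ∈ Z, -17440 ≤ v ∧ v ≤ 17440 := by
  intro v hv
  simp only [Z, mem_union, mem_Q02, mem_Q10] at hv
  rcases hv with ⟨a, b, ha, hb, rfl⟩ | ⟨a, b, ha, hb, rfl⟩ <;>
  ( obtain ⟨_, _⟩ := P_bounds ha; obtain ⟨_, _⟩ := P_bounds hb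
    constructor <;> omega )

/-- Summary: an equilateral-trapezoid-free triple (target `0`) inside `[-17952, 17952]² × [-17440, 17440]` with at
least `54000 > 53345` solutions of `a + b + c = 0`; after translation, `Val(53344) ≥ 54000` in Pratt's sense. -/
theorem val_witness_XYZ :
    TrapezoidFree X Y Z 0 ∧ 54000 ≤ (solutions X Y Z 0).card ∧
    (∀ v ∈ X, -17952 ≤ v ∧ v ≤ 17952) ∧ (∀ v ∈ Y, -17952 ≤ v ∧ v ≤ 17952) ∧
      (∀ v ∈ Z, -17440 ≤ v ∧ v ≤ 17440) :=
  ⟨trapezoidFree_XYZ, card_solutions_ge, X_bound, Y_bound, Z_bound⟩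

end Summit.MatrixMultiplication.MatrixMultiplication.Theorems.SoloVal
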